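import Summits.CriticalPhenomena.PercolationContinuityZ3.Theorems.PercNearOneGluingNoHeavyLowerTailSahiCombTriWBotEmpty

/-!
# More unconditional strata of `TRI_W(2) ≥ 0`: one family vanishing at the bottom index, the other full at the top index; and the `F ↔ G` symmetry of `triW`

Support file of the one-cut programme (crux `NoHeavyLowerTail`, stmt-CriticalPhenomena-4575; cell `prim-masterthm`, seat P5 gen 15;
report `P5-LORENTZIAN-TEST.md` §19).  Continuation of `…SahiCombTriWBotEmpty` (stratum `F ∅ = G ∅ = ∅`).

* **`FiveUpSet.inner_pair_le_of_left_bot_right_top`** — for up-sets `P`, `A, B ⊆ F₁`, `G₀ ⊆ C, D` of a finite cube: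
  `0 ≤ triWOne c P ∅ F₁ G₀ univ + triWOne c P A B C D`.
  This is the pair form (`LatticeFiveUpSet.triW_nonneg_of_pair_nonneg`) of `TRI_W(2) ≥ 0` on the MIXED stratum `F ∅ = ∅`, `G univ = univ` (the bottom value of `G` and
  the top value of `F` arbitrary).  PROOF: a pointwise certificate found by the column-generation LP over the 5,184 local types (report §19.2, kit j132987 → j133054) and
  kernel-checked here: the sum dominates ten instances of the five-up-set theorem `fiveUpSetIneq_holds` — among them instances whose 'P-slot' is `G{a}` or `P ∩ (G{a} ∪ G{b})`
  and whose nested pair is `(P ∩ G{b} ⊆ P)` — and the remainder, written as a sum over ALL points `w` of the cube (`card_eq_univ_sum`), is non-negative on every antipodal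
  PAIR `{w, wᶜ}` (`sum_nonneg_of_compl_pair`; `6⁴` diamond positions × the two `P`-memberships, kernel `decide`).  Unlike the bottom stratum, no per-point certificate exists
  here (LP value `−1/4` per point, `0` per antipodal pair).
* **`FiveUpSet.triW_symm`** — `triW P F G = triW P G F` for every index cube (reindex two of the five sums by `x ↦ xᶜ`).
* **`FiveUpSet.triW_nonneg_of_left_bot_right_top`** / **`…_of_right_bot_left_top`** — index cube with two atoms, up-set `P`, monotone families of up-sets with
  `F ∅ = ∅ ∧ G univ = univ` (resp. `G ∅ = ∅ ∧ F univ = univ`): `0 ≤ triW P F G`.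
NOT obtainable by pointwise certificates (LP no-go values per unit type mass, report §19.3): the one-sided stratum `F ∅ = ∅` (`−0.079`), the top stratum
`F univ = G univ = univ` (`−0.077`), `G ∅ = G{a}` (`−1/12`), and `TriWIneq` at `a = 2` itself (`−0.120`; `−0.095` even granting exact pairwise Harris correlations).
HONEST LABEL: two more unconditional strata of `TriWIneq` at `a = 2` and a symmetry lemma; `TriWIneq` remains OPEN. [this work]
-/

namespace Summit.CriticalPhenomena.PercolationContinuityZ3.Theorems

namespace FiveUpSet

open Finset

variable {γ : Type} [DecidableEq γ] [Fintype γ]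

/-- Every cardinality of a family of subsets of the cube as a sum of an indicator over ALL points (normal form for pointwise certificates). [this work] -/
theorem card_eq_univ_sum (E : Finset (Finset γ)) : ((E.card : ℕ) : ℤ) = ∑ w : Finset γ, (if w ∈ E then (1 : ℤ) else 0) := by
  rw [Finset.sum_boole]; simp

omit [DecidableEq γ] in
/-- The full family is an up-set. [this work] -/
theorem isUpperSet_univ_family : IsUpperSet ((univ : Finset (Finset γ)) : Set (Finset γ)) := by
  rw [coe_univ]; exact isUpperSet_univ

omit [Fintype γ] in
/-- Intersections of up-set families are up-sets (term-mode helper). [this work] -/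
theorem isUpperSet_inter_family {X Y : Finset (Finset γ)} (hX : IsUpperSet (X : Set (Finset γ))) (hY : IsUpperSet (Y : Set (Finset γ))) :
    IsUpperSet ((X ∩ Y : Finset (Finset γ)) : Set (Finset γ)) := by
  rw [coe_inter]; exact hX.inter hY

omit [Fintype γ] in
/-- Unions of up-set families are up-sets (term-mode helper). [this work] -/
theorem isUpperSet_union_family {X Y : Finset (Finset γ)} (hX : IsUpperSet (X : Set (Finset γ))) (hY : IsUpperSet (Y : Set (Finset γ))) :
    IsUpperSet ((X ∪ Y : Finset (Finset γ)) : Set (Finset γ)) := by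
  rw [coe_union]; exact hX.union hY

/-- Antipodal pairing: if `f w + f wᶜ ≥ 0` for every point then `Σ_w f w ≥ 0` (the sum is invariant under `w ↦ wᶜ`). [this work] -/
theorem sum_nonneg_of_compl_pair {f : Finset γ → ℤ} (h : ∀ w : Finset γ, 0 ≤ f w + f wᶜ) : 0 ≤ ∑ w : Finset γ, f w := by
  have e : ∑ w : Finset γ, f wᶜ = ∑ w : Finset γ, f w :=
    Fintype.sum_equiv (complEquiv γ) (fun w => f wᶜ) f (fun w => rfl)
  have h2 : 0 ≤ ∑ w : Finset γ, (f w + f wᶜ) := Finset.sum_nonneg fun w _ => h w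
  rw [Finset.sum_add_distrib, e] at h2
  linarith

set_option maxHeartbeats 1600000 in
set_option maxRecDepth 16384 in
set_option linter.unusedSimpArgs false in
/-- **`TRI_W(2) ≥ 0` on the mixed stratum `F ∅ = ∅`, `G univ = univ`, pair form.**  For up-sets `P`, `A, B ⊆ F₁`, `G₀ ⊆ C, D` of a finite cube,
`0 ≤ triWOne c P ∅ F₁ G₀ univ + triWOne c P A B C D` (`c` = complementation).  Ten five-up-set instances plus a remainder that is non-negative on every
antipodal pair `{w, wᶜ}` (see the module docstring). [this work] -/
theorem inner_pair_le_of_left_bot_right_top (P A B F₁ G₀ C D : Finset (Finset γ)) (hP : IsUpperSet (P : Set (Finset γ)))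
    (hA : IsUpperSet (A : Set (Finset γ))) (hB : IsUpperSet (B : Set (Finset γ))) (hF₁ : IsUpperSet (F₁ : Set (Finset γ)))
    (hG₀ : IsUpperSet (G₀ : Set (Finset γ))) (hC : IsUpperSet (C : Set (Finset γ))) (hD : IsUpperSet (D : Set (Finset γ)))
    (hA1 : A ⊆ F₁) (hB1 : B ⊆ F₁) (h0C : G₀ ⊆ C) (h0D : G₀ ⊆ D) :
    0 ≤ LatticeFiveUpSet.triWOne (complEquiv γ) P (∅ : Finset (Finset γ)) F₁ G₀ (univ : Finset (Finset γ)) + LatticeFiveUpSet.triWOne (complEquiv γ) P A B C D := by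
  have e0 : LatticeFiveUpSet.triWOne (complEquiv γ) P (∅ : Finset (Finset γ)) F₁ G₀ (univ : Finset (Finset γ)) = 2 * ((P ∩ (∅ : Finset (Finset γ)) ∩ G₀).card : ℤ) + 2 * ((P ∩ F₁ ∩ (univ : Finset (Finset γ))).card : ℤ) - ((P ∩ refl (∅ : Finset (Finset γ)) ∩ (univ : Finset (Finset γ))).card : ℤ) - ((P ∩ refl F₁ ∩ G₀).card : ℤ) - ((P ∩ (∅ : Finset (Finset γ)) ∩ refl (univ : Finset (Finset γ))).card : ℤ) - ((P ∩ F₁ ∩ refl G₀).card : ℤ) - ((P ∩ refl (∅ : Finset (Finset γ)) ∩ refl G₀).card : ℤ) - ((P ∩ refl F₁ ∩ refl (univ : Finset (Finset γ))).card : ℤ) + ((P ∩ refl (∅ : Finset (Finset γ)) ∩ refl (univ : Finset (Finset γ))).card : ℤ) + ((P ∩ refl F₁ ∩ refl G₀).card : ℤ) := by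
    unfold LatticeFiveUpSet.triWOne; simp only [image_complEquiv]; ring
  have e1 : LatticeFiveUpSet.triWOne (complEquiv γ) P A B C D = 2 * ((P ∩ A ∩ C).card : ℤ) + 2 * ((P ∩ B ∩ D).card : ℤ) - ((P ∩ refl A ∩ D).card : ℤ) - ((P ∩ refl B ∩ C).card : ℤ) - ((P ∩ A ∩ refl D).card : ℤ) - ((P ∩ B ∩ refl C).card : ℤ) - ((P ∩ refl A ∩ refl C).card : ℤ) - ((P ∩ refl B ∩ refl D).card : ℤ) + ((P ∩ refl A ∩ refl D).card : ℤ) + ((P ∩ refl B ∩ refl C).card : ℤ) := by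
    unfold LatticeFiveUpSet.triWOne; simp only [image_complEquiv]; ring
  rw [e0, e1]
  have h1 := fiveUpSetIneq_holds γ (P ∩ G₀) (univ : Finset (Finset γ)) (univ : Finset (Finset γ)) F₁ F₁ (isUpperSet_inter_family hP hG₀) isUpperSet_univ_family isUpperSet_univ_family hF₁ hF₁ subset_rfl subset_rfl
  have h2 := fiveUpSetIneq_holds γ P (∅ : Finset (Finset γ)) F₁ ((univ : Finset (Finset γ)) ∩ G₀) (univ : Finset (Finset γ)) hP isUpperSet_empty hF₁ (isUpperSet_inter_family isUpperSet_univ_family hG₀) isUpperSet_univ_family (empty_subset _) inter_subset_left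
  have h3 := fiveUpSetIneq_holds γ P (A ∩ B) A (∅ : Finset (Finset γ)) (C ∩ (univ : Finset (Finset γ))) hP (isUpperSet_inter_family hA hB) hA isUpperSet_empty (isUpperSet_inter_family hC isUpperSet_univ_family) inter_subset_left (empty_subset _)
  have h4 := fiveUpSetIneq_holds γ P (B ∩ A) B (∅ : Finset (Finset γ)) (D ∩ (univ : Finset (Finset γ))) hP (isUpperSet_inter_family hB hA) hB isUpperSet_empty (isUpperSet_inter_family hD isUpperSet_univ_family) inter_subset_left (empty_subset _)
  have h5 := fiveUpSetIneq_holds γ P C (univ : Finset (Finset γ)) ((B ∩ F₁) ∩ (∅ : Finset (Finset γ))) (B ∩ F₁) hP hC isUpperSet_univ_family (isUpperSet_inter_family (isUpperSet_inter_family hB hF₁) isUpperSet_empty) (isUpperSet_inter_family hB hF₁) (subset_univ _) inter_subset_left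
  have h6 := fiveUpSetIneq_holds γ P D (univ : Finset (Finset γ)) ((A ∩ F₁) ∩ (∅ : Finset (Finset γ))) (A ∩ F₁) hP hD isUpperSet_univ_family (isUpperSet_inter_family (isUpperSet_inter_family hA hF₁) isUpperSet_empty) (isUpperSet_inter_family hA hF₁) (subset_univ _) inter_subset_left
  have h7 := fiveUpSetIneq_holds γ C (P ∩ D) P (∅ : Finset (Finset γ)) A hC (isUpperSet_inter_family hP hD) hP isUpperSet_empty hA inter_subset_left (empty_subset _)
  have h8 := fiveUpSetIneq_holds γ D (P ∩ C) P (∅ : Finset (Finset γ)) B hD (isUpperSet_inter_family hP hC) hP isUpperSet_empty hB inter_subset_left (empty_subset _)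
  have h9 := fiveUpSetIneq_holds γ (P ∩ (C ∪ D)) (∅ : Finset (Finset γ)) A ((univ : Finset (Finset γ)) ∩ (B ∪ D)) (univ : Finset (Finset γ)) (isUpperSet_inter_family hP (isUpperSet_union_family hC hD)) isUpperSet_empty hA (isUpperSet_inter_family isUpperSet_univ_family (isUpperSet_union_family hB hD)) isUpperSet_univ_family (empty_subset _) inter_subset_left
  have h10 := fiveUpSetIneq_holds γ (P ∩ (D ∪ C)) (∅ : Finset (Finset γ)) B ((univ : Finset (Finset γ)) ∩ (A ∪ C)) (univ : Finset (Finset γ)) (isUpperSet_inter_family hP (isUpperSet_union_family hD hC)) isUpperSet_empty hB (isUpperSet_inter_family isUpperSet_univ_family (isUpperSet_union_family hA hC)) isUpperSet_univ_family (empty_subset _) inter_subset_left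
  have h1' : 0 ≤ (((P ∩ G₀) ∩ (univ : Finset (Finset γ)) ∩ F₁).card : ℤ) + (((P ∩ G₀) ∩ (univ : Finset (Finset γ)) ∩ F₁).card : ℤ) - (((P ∩ G₀) ∩ (univ : Finset (Finset γ)) ∩ refl F₁).card : ℤ) - (((P ∩ G₀) ∩ refl (univ : Finset (Finset γ)) ∩ F₁).card : ℤ) - (((P ∩ G₀) ∩ refl ((univ : Finset (Finset γ)) \ (univ : Finset (Finset γ))) ∩ refl (F₁ \ F₁)).card : ℤ) := by
    have := h1; omega
  have h2' : 0 ≤ ((P ∩ F₁ ∩ (univ : Finset (Finset γ))).card : ℤ) + ((P ∩ (∅ : Finset (Finset γ)) ∩ ((univ : Finset (Finset γ)) ∩ G₀)).card : ℤ) - ((P ∩ F₁ ∩ refl ((univ : Finset (Finset γ)) ∩ G₀)).card : ℤ) - ((P ∩ refl (∅ : Finset (Finset γ)) ∩ (univ : Finset (Finset γ))).card : ℤ) - ((P ∩ refl (F₁ \ (∅ : Finset (Finset γ))) ∩ refl ((univ : Finset (Finset γ)) \ ((univ : Finset (Finset γ)) ∩ G₀))).card : ℤ) := by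
    have := h2; omega
  have h3' : 0 ≤ ((P ∩ A ∩ (C ∩ (univ : Finset (Finset γ)))).card : ℤ) + ((P ∩ (A ∩ B) ∩ (∅ : Finset (Finset γ))).card : ℤ) - ((P ∩ A ∩ refl (∅ : Finset (Finset γ))).card : ℤ) - ((P ∩ refl (A ∩ B) ∩ (C ∩ (univ : Finset (Finset γ)))).card : ℤ) - ((P ∩ refl (A \ (A ∩ B)) ∩ refl ((C ∩ (univ : Finset (Finset γ))) \ (∅ : Finset (Finset γ)))).card : ℤ) := by
    have := h3; omega
  have h4' : 0 ≤ ((P ∩ B ∩ (D ∩ (univ : Finset (Finset γ)))).card : ℤ) + ((P ∩ (B ∩ A) ∩ (∅ : Finset (Finset γ))).card : ℤ) - ((P ∩ B ∩ refl (∅ : Finset (Finset γ))).card : ℤ) - ((P ∩ refl (B ∩ A) ∩ (D ∩ (univ : Finset (Finset γ)))).card : ℤ) - ((P ∩ refl (B \ (B ∩ A)) ∩ refl ((D ∩ (univ : Finset (Finset γ))) \ (∅ : Finset (Finset γ)))).card : ℤ) := by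
    have := h4; omega
  have h5' : 0 ≤ ((P ∩ (univ : Finset (Finset γ)) ∩ (B ∩ F₁)).card : ℤ) + ((P ∩ C ∩ ((B ∩ F₁) ∩ (∅ : Finset (Finset γ)))).card : ℤ) - ((P ∩ (univ : Finset (Finset γ)) ∩ refl ((B ∩ F₁) ∩ (∅ : Finset (Finset γ)))).card : ℤ) - ((P ∩ refl C ∩ (B ∩ F₁)).card : ℤ) - ((P ∩ refl ((univ : Finset (Finset γ)) \ C) ∩ refl ((B ∩ F₁) \ ((B ∩ F₁) ∩ (∅ : Finset (Finset γ))))).card : ℤ) := by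
    have := h5; omega
  have h6' : 0 ≤ ((P ∩ (univ : Finset (Finset γ)) ∩ (A ∩ F₁)).card : ℤ) + ((P ∩ D ∩ ((A ∩ F₁) ∩ (∅ : Finset (Finset γ)))).card : ℤ) - ((P ∩ (univ : Finset (Finset γ)) ∩ refl ((A ∩ F₁) ∩ (∅ : Finset (Finset γ)))).card : ℤ) - ((P ∩ refl D ∩ (A ∩ F₁)).card : ℤ) - ((P ∩ refl ((univ : Finset (Finset γ)) \ D) ∩ refl ((A ∩ F₁) \ ((A ∩ F₁) ∩ (∅ : Finset (Finset γ))))).card : ℤ) := by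
    have := h6; omega
  have h7' : 0 ≤ ((C ∩ P ∩ A).card : ℤ) + ((C ∩ (P ∩ D) ∩ (∅ : Finset (Finset γ))).card : ℤ) - ((C ∩ P ∩ refl (∅ : Finset (Finset γ))).card : ℤ) - ((C ∩ refl (P ∩ D) ∩ A).card : ℤ) - ((C ∩ refl (P \ (P ∩ D)) ∩ refl (A \ (∅ : Finset (Finset γ)))).card : ℤ) := by
    have := h7; omega
  have h8' : 0 ≤ ((D ∩ P ∩ B).card : ℤ) + ((D ∩ (P ∩ C) ∩ (∅ : Finset (Finset γ))).card : ℤ) - ((D ∩ P ∩ refl (∅ : Finset (Finset γ))).card : ℤ) - ((D ∩ refl (P ∩ C) ∩ B).card : ℤ) - ((D ∩ refl (P \ (P ∩ C)) ∩ refl (B \ (∅ : Finset (Finset γ)))).card : ℤ) := by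
    have := h8; omega
  have h9' : 0 ≤ (((P ∩ (C ∪ D)) ∩ A ∩ (univ : Finset (Finset γ))).card : ℤ) + (((P ∩ (C ∪ D)) ∩ (∅ : Finset (Finset γ)) ∩ ((univ : Finset (Finset γ)) ∩ (B ∪ D))).card : ℤ) - (((P ∩ (C ∪ D)) ∩ A ∩ refl ((univ : Finset (Finset γ)) ∩ (B ∪ D))).card : ℤ) - (((P ∩ (C ∪ D)) ∩ refl (∅ : Finset (Finset γ)) ∩ (univ : Finset (Finset γ))).card : ℤ) - (((P ∩ (C ∪ D)) ∩ refl (A \ (∅ : Finset (Finset γ))) ∩ refl ((univ : Finset (Finset γ)) \ ((univ : Finset (Finset γ)) ∩ (B ∪ D)))).card : ℤ) := by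
    have := h9; omega
  have h10' : 0 ≤ (((P ∩ (D ∪ C)) ∩ B ∩ (univ : Finset (Finset γ))).card : ℤ) + (((P ∩ (D ∪ C)) ∩ (∅ : Finset (Finset γ)) ∩ ((univ : Finset (Finset γ)) ∩ (A ∪ C))).card : ℤ) - (((P ∩ (D ∪ C)) ∩ B ∩ refl ((univ : Finset (Finset γ)) ∩ (A ∪ C))).card : ℤ) - (((P ∩ (D ∪ C)) ∩ refl (∅ : Finset (Finset γ)) ∩ (univ : Finset (Finset γ))).card : ℤ) - (((P ∩ (D ∪ C)) ∩ refl (B \ (∅ : Finset (Finset γ))) ∩ refl ((univ : Finset (Finset γ)) \ ((univ : Finset (Finset γ)) ∩ (A ∪ C)))).card : ℤ) := by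
    have := h10; omega
  have hR : 0 ≤ 4 * ((P ∩ (∅ : Finset (Finset γ)) ∩ G₀).card : ℤ) + 2 * ((P ∩ F₁ ∩ (univ : Finset (Finset γ))).card : ℤ) - 2 * ((P ∩ refl F₁ ∩ G₀).card : ℤ) - 2 * ((P ∩ (∅ : Finset (Finset γ)) ∩ refl (univ : Finset (Finset γ))).card : ℤ) - 2 * ((P ∩ F₁ ∩ refl G₀).card : ℤ) - 2 * ((P ∩ refl (∅ : Finset (Finset γ)) ∩ refl G₀).card : ℤ) - 2 * ((P ∩ refl F₁ ∩ refl (univ : Finset (Finset γ))).card : ℤ) + 2 * ((P ∩ refl (∅ : Finset (Finset γ)) ∩ refl (univ : Finset (Finset γ))).card : ℤ) + 2 * ((P ∩ refl F₁ ∩ refl G₀).card : ℤ) + 4 * ((P ∩ A ∩ C).card : ℤ) + 4 * ((P ∩ B ∩ D).card : ℤ) - 2 * ((P ∩ refl A ∩ D).card : ℤ) - 2 * ((P ∩ refl B ∩ C).card : ℤ) - 2 * ((P ∩ A ∩ refl D).card : ℤ) - 2 * ((P ∩ B ∩ refl C).card : ℤ) - 2 * ((P ∩ refl A ∩ refl C).card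 : ℤ) - 2 * ((P ∩ refl B ∩ refl D).card : ℤ) + 2 * ((P ∩ refl A ∩ refl D).card : ℤ) + 2 * ((P ∩ refl B ∩ refl C).card : ℤ) - 4 * (((P ∩ G₀) ∩ (univ : Finset (Finset γ)) ∩ F₁).card : ℤ) + 2 * (((P ∩ G₀) ∩ (univ : Finset (Finset γ)) ∩ refl F₁).card : ℤ) + 2 * (((P ∩ G₀) ∩ refl (univ : Finset (Finset γ)) ∩ F₁).card : ℤ) + 2 * (((P ∩ G₀) ∩ refl ((univ : Finset (Finset γ)) \ (univ : Finset (Finset γ))) ∩ refl (F₁ \ F₁)).card : ℤ) - 2 * ((P ∩ (∅ : Finset (Finset γ)) ∩ ((univ : Finset (Finset γ)) ∩ G₀)).card : ℤ) + 2 * ((P ∩ F₁ ∩ refl ((univ : Finset (Finset γ)) ∩ G₀)).card : ℤ) + 2 * ((P ∩ refl (F₁ \ (∅ : Finset (Finset γ))) ∩ refl ((univ : Finset (Finset γ)) \ ((univ : Finset (Finset γ)) ∩ G₀))).card : ℤ) - ((P ∩ A ∩ (C ∩ (univ : Finset (Finset γ)))).card : ℤ) - ((P ∩ (A ∩ B)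 ∩ (∅ : Finset (Finset γ))).card : ℤ) + ((P ∩ A ∩ refl (∅ : Finset (Finset γ))).card : ℤ) + ((P ∩ refl (A ∩ B) ∩ (C ∩ (univ : Finset (Finset γ)))).card : ℤ) + ((P ∩ refl (A \ (A ∩ B)) ∩ refl ((C ∩ (univ : Finset (Finset γ))) \ (∅ : Finset (Finset γ)))).card : ℤ) - ((P ∩ B ∩ (D ∩ (univ : Finset (Finset γ)))).card : ℤ) - ((P ∩ (B ∩ A) ∩ (∅ : Finset (Finset γ))).card : ℤ) + ((P ∩ B ∩ refl (∅ : Finset (Finset γ))).card : ℤ) + ((P ∩ refl (B ∩ A) ∩ (D ∩ (univ : Finset (Finset γ)))).card : ℤ) + ((P ∩ refl (B \ (B ∩ A)) ∩ refl ((D ∩ (univ : Finset (Finset γ))) \ (∅ : Finset (Finset γ)))).card : ℤ) - ((P ∩ (univ : Finset (Finset γ)) ∩ (B ∩ F₁)).card : ℤ) - ((P ∩ C ∩ ((B ∩ F₁) ∩ (∅ : Finset (Finset γ)))).card : ℤ) + ((P ∩ (univ : Finset (Finset γ)) ∩ refl ((B ∩ F₁) ∩ (∅ : Finset (Finset γ)))).card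 : ℤ) + ((P ∩ refl C ∩ (B ∩ F₁)).card : ℤ) + ((P ∩ refl ((univ : Finset (Finset γ)) \ C) ∩ refl ((B ∩ F₁) \ ((B ∩ F₁) ∩ (∅ : Finset (Finset γ))))).card : ℤ) - ((P ∩ (univ : Finset (Finset γ)) ∩ (A ∩ F₁)).card : ℤ) - ((P ∩ D ∩ ((A ∩ F₁) ∩ (∅ : Finset (Finset γ)))).card : ℤ) + ((P ∩ (univ : Finset (Finset γ)) ∩ refl ((A ∩ F₁) ∩ (∅ : Finset (Finset γ)))).card : ℤ) + ((P ∩ refl D ∩ (A ∩ F₁)).card : ℤ) + ((P ∩ refl ((univ : Finset (Finset γ)) \ D) ∩ refl ((A ∩ F₁) \ ((A ∩ F₁) ∩ (∅ : Finset (Finset γ))))).card : ℤ) - ((C ∩ P ∩ A).card : ℤ) - ((C ∩ (P ∩ D) ∩ (∅ : Finset (Finset γ))).card : ℤ) + ((C ∩ P ∩ refl (∅ : Finset (Finset γ))).card : ℤ) + ((C ∩ refl (P ∩ D) ∩ A).card : ℤ) + ((C ∩ refl (P \ (P ∩ D)) ∩ refl (A \ (∅ : Finset (Finset γ)))).card :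 ℤ) - ((D ∩ P ∩ B).card : ℤ) - ((D ∩ (P ∩ C) ∩ (∅ : Finset (Finset γ))).card : ℤ) + ((D ∩ P ∩ refl (∅ : Finset (Finset γ))).card : ℤ) + ((D ∩ refl (P ∩ C) ∩ B).card : ℤ) + ((D ∩ refl (P \ (P ∩ C)) ∩ refl (B \ (∅ : Finset (Finset γ)))).card : ℤ) - (((P ∩ (C ∪ D)) ∩ A ∩ (univ : Finset (Finset γ))).card : ℤ) - (((P ∩ (C ∪ D)) ∩ (∅ : Finset (Finset γ)) ∩ ((univ : Finset (Finset γ)) ∩ (B ∪ D))).card : ℤ) + (((P ∩ (C ∪ D)) ∩ A ∩ refl ((univ : Finset (Finset γ)) ∩ (B ∪ D))).card : ℤ) + (((P ∩ (C ∪ D)) ∩ refl (∅ : Finset (Finset γ)) ∩ (univ : Finset (Finset γ))).card : ℤ) + (((P ∩ (C ∪ D)) ∩ refl (A \ (∅ : Finset (Finset γ))) ∩ refl ((univ : Finset (Finset γ)) \ ((univ : Finset (Finset γ)) ∩ (B ∪ D)))).card : ℤ) - (((P ∩ (D ∪ C)) ∩ B ∩ (univ : Finset (Finset γ))).card : ℤ)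 - (((P ∩ (D ∪ C)) ∩ (∅ : Finset (Finset γ)) ∩ ((univ : Finset (Finset γ)) ∩ (A ∪ C))).card : ℤ) + (((P ∩ (D ∪ C)) ∩ B ∩ refl ((univ : Finset (Finset γ)) ∩ (A ∪ C))).card : ℤ) + (((P ∩ (D ∪ C)) ∩ refl (∅ : Finset (Finset γ)) ∩ (univ : Finset (Finset γ))).card : ℤ) + (((P ∩ (D ∪ C)) ∩ refl (B \ (∅ : Finset (Finset γ))) ∩ refl ((univ : Finset (Finset γ)) \ ((univ : Finset (Finset γ)) ∩ (A ∪ C)))).card : ℤ) := by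
    simp only [card_eq_univ_sum]
    simp only [mem_inter, mem_refl, mem_sdiff, mem_union, mem_univ, Finset.notMem_empty, true_and, and_true, false_and, and_false, Finset.mul_sum, ← Finset.sum_add_distrib, ← Finset.sum_sub_distrib]
    refine sum_nonneg_of_compl_pair (fun w => ?_)
    simp only [compl_compl]
    obtain ⟨s₁, a0, ap, aq, a1⟩ := diamond_pos (empty_subset A) (empty_subset B) hA1 hB1 w
    obtain ⟨s₂, b0, bp, bq, b1⟩ := diamond_pos h0C h0D (subset_univ C) (subset_univ D) w
    obtain ⟨s₃, c0, cp, cq, c1⟩ := diamond_pos (empty_subset A) (empty_subset B) hA1 hB1 wᶜ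
    obtain ⟨s₄, d0, dp, dq, d1⟩ := diamond_pos h0C h0D (subset_univ C) (subset_univ D) wᶜ
    by_cases hw : w ∈ P <;> by_cases hw' : wᶜ ∈ P <;>
      simp only [hw, hw', a0, ap, aq, a1, b0, bp, bq, b1, c0, cp, cq, c1, d0, dp, dq, d1] <;>
      clear a0 ap aq a1 b0 bp bq b1 c0 cp cq c1 d0 dp dq d1 hw hw' <;>
      revert s₂ s₃ s₄ <;>
      fin_cases s₁ <;>
      decide
  linarith [hR, h1', h2', h3', h4', h5', h6', h7', h8', h9', h10']

/-- **`TRI_W(a)` is symmetric in the two families:** `triW P F G = triW P G F` for every index cube (two of the five sums are reindexed by `x ↦ xᶜ`). [this work] -/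
theorem triW_symm {β : Type} [DecidableEq β] [Fintype β] (P : Finset (Finset γ)) (F G : Finset β → Finset (Finset γ)) :
    triW P F G = triW P G F := by
  unfold triW triWTerm
  have h1 : ∑ x : Finset β, ((P ∩ refl (G x) ∩ F xᶜ).card : ℤ) = ∑ x : Finset β, ((P ∩ F x ∩ refl (G xᶜ)).card : ℤ) :=
    Fintype.sum_equiv (complEquiv β) _ _ (fun x => by
      change _ = ((P ∩ F xᶜ ∩ refl (G xᶜᶜ)).card : ℤ); rw [compl_compl, inter_right_comm])
  have h2 : ∑ x : Finset β, ((P ∩ G x ∩ refl (F xᶜ)).card : ℤ) = ∑ x : Finset β, ((P ∩ refl (F x) ∩ G xᶜ).card : ℤ) :=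
    Fintype.sum_equiv (complEquiv β) _ _ (fun x => by
      change _ = ((P ∩ refl (F xᶜ) ∩ G xᶜᶜ).card : ℤ); rw [compl_compl, inter_right_comm])
  have h3 : ∑ x : Finset β, ((P ∩ refl (G x) ∩ refl (F xᶜ)).card : ℤ) = ∑ x : Finset β, ((P ∩ refl (F x) ∩ refl (G xᶜ)).card : ℤ) :=
    Fintype.sum_equiv (complEquiv β) _ _ (fun x => by
      change _ = ((P ∩ refl (F xᶜ) ∩ refl (G xᶜᶜ)).card : ℤ); rw [compl_compl, inter_right_comm])
  have h4 : ∀ x : Finset β, ((P ∩ G x ∩ F x).card : ℤ) = ((P ∩ F x ∩ G x).card : ℤ) := fun x => by rw [inter_right_comm]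
  have h5 : ∀ x : Finset β, ((P ∩ refl (G x) ∩ refl (F x)).card : ℤ) = ((P ∩ refl (F x) ∩ refl (G x)).card : ℤ) := fun x => by rw [inter_right_comm]
  simp only [Finset.sum_add_distrib, Finset.sum_sub_distrib, h4, h5] at *
  rw [h1, h2, h3]
  ring

/-- **MIXED STRATUM `F ∅ = ∅`, `G univ = univ` of `TRI_W(2) ≥ 0` (unconditional):** index cube with two atoms `a ≠ b`, up-set `P`, monotone families `F, G` of
up-sets of a finite cube with `F ∅ = ∅` and `G univ = univ`: `0 ≤ triW P F G`. [this work] -/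
theorem triW_nonneg_of_left_bot_right_top {β : Type} [DecidableEq β] [Fintype β] {a b : β} (hab : a ≠ b) (hu : (univ : Finset β) = {a, b})
    (P : Finset (Finset γ)) (F G : Finset β → Finset (Finset γ))
    (hP : IsUpperSet (P : Set (Finset γ))) (hF : ∀ x, IsUpperSet (F x : Set (Finset γ))) (hG : ∀ x, IsUpperSet (G x : Set (Finset γ)))
    (hFm : Monotone F) (hGm : Monotone G) (hF0 : F ∅ = ∅) (hG1 : G univ = univ) : 0 ≤ triW P F G := by
  refine LatticeFiveUpSet.triW_nonneg_of_pair_nonneg hab hu P F G ?_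
  rw [hF0, hG1]
  exact inner_pair_le_of_left_bot_right_top P (F {a}) (F {b}) (F univ) (G ∅) (G {a}) (G {b}) hP (hF {a}) (hF {b}) (hF univ)
    (hG ∅) (hG {a}) (hG {b}) (hFm (subset_univ _)) (hFm (subset_univ _)) (hGm (empty_subset _)) (hGm (empty_subset _))

/-- The mirror stratum `G ∅ = ∅`, `F univ = univ` (by `triW_symm`). [this work] -/
theorem triW_nonneg_of_right_bot_left_top {β : Type} [DecidableEq β] [Fintype β] {a b : β} (hab : a ≠ b) (hu : (univ : Finset β) = {a, b})
    (P : Finset (Finset γ)) (F G : Finset β → Finset (Finset γ))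
    (hP : IsUpperSet (P : Set (Finset γ))) (hF : ∀ x, IsUpperSet (F x : Set (Finset γ))) (hG : ∀ x, IsUpperSet (G x : Set (Finset γ)))
    (hFm : Monotone F) (hGm : Monotone G) (hG0 : G ∅ = ∅) (hF1 : F univ = univ) : 0 ≤ triW P F G := by
  rw [triW_symm]
  exact triW_nonneg_of_left_bot_right_top hab hu P G F hP hG hF hGm hFm hG0 hF1

end FiveUpSet

end Summit.CriticalPhenomena.PercolationContinuityZ3.Theorems
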